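/-
Copyright (c) 2026 the pub-hodgecm-mathlib formalisation cell (harness21).  Prover seat hodgecm-mathlib-K2-defs1 (g7) (K2 currency desk ∕ R90-TF currency chair) as S2 FALLBACK
TYPIST + FILER (S2 dealer K2E1b-plan (g7) 2026-09-04T21:33:12Z); content = R90-C11-audit1 (g0)'s PROBE `PROBE_HDefs_H1` 21:32:50Z (PIN 1 verbatim, PIN 2 in e-currency).
-/
import Summits.HodgeConjecture.HodgeConjecture.Theorems.R90S2ArchKitHDefs   -- ★ (P-4) `expVec`, `placeExp`, `archCharOfExponents` (e-currency), `xiArchChar_eq_archCharOfExponents`, `archTrHOfRecord`, `archTrHOfRecord_xiTok`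
import HarnessLib

/-!
# R90-TF ∕ S2 — the two PINS of RULING S2-R11′ (H-1) for the `H_∞`-kit of record: `expVec_expAt` and `archTrHOfRecord_xiTok_ofRecord`

Cell `pub/hodgecm-mathlib`, crux H413 = `stmt-HodgeConjecture-24833`.  THEOREMS ONLY (no `def`, no `instance`, no notation, no `sorry`).  Companion leaf of ★
`Theorems/R90S2ArchKitHDefs.lean` (ED. 3a v2): the two pins the S2 dealer made mandatory (21:33:12Z) do not fit under the gate's 400-line limit for Theorems files
with proofs inside the defs file (394 → 424 l.), so they live here (defs down, payments up — L9).  PIN 1: the exponent vector `expVec ι (expAt e ι) (e ∘ val)` IS `e`.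
PIN 2: at the token `(xiTok (pη ξ ι) (qψ ξ ι), (eη, eψ) ∘ val)` of a GLOBAL one-dimensional automorphic `ξ`, the trace of record integrates `ξ_∞` ITSELF,
`archTrHOfRecord … aH = ∫ aH · ξ_∞ dνHi` — the Lean certificate that the H-1 orientation slip (conjugate character) found by R90-C11-audit1's probe on the ED. 3a v1 cand
(ec69bf6358b3c119) is gone in v2 (e-currency `archCharOfExponents e₁ e₂ := archWeight (−e₁) · archWeight (−e₂)`).  Both proofs elaborated against the v2 defs in the
desk's probe `K2/K2-defs1/g7/PROBE_R90S2ArchKitHDefs.v2_with_pins.K2-defs1-g7.lean` (sha16 1b9137b14f2aaf9a, farm rc 0 ∕ [] ∕ s0, TRIO on PIN 2).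
HONEST LABEL: HC_CM is proved only modulo the 7 printed citations (2 remaining named inputs: hLiu418 = `stmt-HodgeConjecture-24832`, h413 = `stmt-HodgeConjecture-24833`) until
rung 0 closes; read-backs, closes no socket; count-neutral.
-/

set_option autoImplicit false
-- the mandated namespace repeats the single-problem summit's segment (`HodgeConjecture.HodgeConjecture`)
set_option linter.dupNamespace false

noncomputable section

open MeasureTheory MeasureTheory.Measure NumberField IsDedekindDomain
open scoped Matrix MatrixGroups Classical

namespace Summit.HodgeConjecture.HodgeConjecture.R90.S2

open Literature.NumberTheory Literature.NumberTheory.Automorphic Literature.NumberTheory.Automorphic.UnitaryGroup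
open Literature.NumberTheory.Rogawski1990 Literature.NumberTheory.GaloisRepresentations
open Summit.HodgeConjecture.HodgeConjecture.Cruxes.H413
open Summit.HodgeConjecture.HodgeConjecture.Cruxes.H413.F0P3InnerFormClassificationV6 (Gp Places Cinf)
open Summit.HodgeConjecture.HodgeConjecture.Cruxes.H413.K2E1bArchCharacterOfOneDim

variable (L : Type) [Field L] [NumberField L] [IsCMField L] (ι : L →+* ℂ)

/-- **PIN 1 (S2-R11′ (H-1)): `expVec ι (expAt e ι) (e ∘ val) = e`** — the exponent vector with `ι`-component `expAt e ι` and compact components read off `e` IS `e`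
(proof = R90-C11-audit1's `probe_expVec_expAt`, PROBE `PROBE_HDefs_H1` 2026-09-04T21:32:50Z, verbatim). [cite: Rogawski1990, §12.3 p. 174] -/
theorem expVec_expAt (e : InfinitePlace L → ℤ) :
    expVec L ι (OneDimAutRepH.expAt e ι) (fun w => e w.1) = e := by
  funext w
  by_cases hw : w = InfinitePlace.mk ι
  · subst hw
    rw [expVec_mk]
    unfold placeExp OneDimAutRepH.expAt
    by_cases h : ι = (InfinitePlace.mk ι).embedding
    · rw [if_pos h, if_pos h, neg_neg]
    · rw [if_neg h, if_neg h]
  · exact expVec_cpt L ι _ _ ⟨w, hw⟩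

variable (X : HInfExt L ι)
  (νHi : @Measure (UnitaryGroup.arch (↥(maximalRealSubfield L)) L (IsCMField.complexConj L) 2 (F0P3InnerFormClassificationV6.splitForm L 2) ×
    UnitaryGroup.arch (↥(maximalRealSubfield L)) L (IsCMField.complexConj L) 1 (F0P3InnerFormClassificationV6.splitForm L 1)) (borel _))

/-- **PIN 2 (S2-R11′ (H-1)): AT THE TOKEN OF A GLOBAL `ξ`, `archTrHOfRecord` integrates `ξ_∞` itself** — `archTrH (xiTok (pη ξ ι) (qψ ξ ι), (eη, eψ)∘val) aH = ∫ aH · ξ_∞ dνHi`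
(PIN 1 twice + the read-back `xiArchChar_eq_archCharOfExponents`; R90-C11-audit1's `probe_archTrH_at_xi_token` in e-currency). [cite: Rogawski1990, §13.3 p. 202; §12.3 Prop. 12.3.3 (a) p. 178] -/
theorem archTrHOfRecord_xiTok_ofRecord (ξ : OneDimAutRepH L)
    (aH : UnitaryGroup.arch (↥(maximalRealSubfield L)) L (IsCMField.complexConj L) 2 (F0P3InnerFormClassificationV6.splitForm L 2) ×
      UnitaryGroup.arch (↥(maximalRealSubfield L)) L (IsCMField.complexConj L) 1 (F0P3InnerFormClassificationV6.splitForm L 1) → ℂ) :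
    archTrHOfRecord L ι νHi X (HTokIota.xiTok (ξ.pη ι) (ξ.qψ ι), fun w => (ξ.eη w.1, ξ.eψ w.1)) aH = ∫ h, aH h * ((xiArchChar L ξ h : ℂˣ) : ℂ) ∂νHi := by
  have h1 : (expVec L ι (ξ.pη ι) fun w => ((ξ.eη w.1, ξ.eψ w.1) : ℤ × ℤ).1) = ξ.eη := expVec_expAt L ι ξ.eη
  have h2 : (expVec L ι (ξ.qψ ι) fun w => ((ξ.eη w.1, ξ.eψ w.1) : ℤ × ℤ).2) = ξ.eψ := expVec_expAt L ι ξ.eψ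
  rw [archTrHOfRecord_xiTok, h1, h2]
  refine integral_congr_ae (Filter.Eventually.of_forall fun h => ?_)
  show aH h * archCharOfExponents L ξ.eη ξ.eψ h = aH h * ((xiArchChar L ξ h : ℂˣ) : ℂ)
  rw [xiArchChar_eq_archCharOfExponents]

end Summit.HodgeConjecture.HodgeConjecture.R90.S2

end
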